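import Summits.AtomisticToContinuum.FouriersLaw.Theorems.HiddenChargeMazurOddChargeAlgebraToolkit

/-!
# Odd conservation laws of the pinned anharmonic chain — toolkit, part B

Second half of the elementary toolkit of the refutation of `HiddenChargeMazur.OddChargeExists`:
the substitutions `killVar v` (`X v ↦ 0`), `killP` (`p ↦ 0`) — a polynomial vanishing on the
hyperplane `X v = 0` is a multiple of `X v` —, supports (`MvPolynomial.supported`) under
`pderiv`, shifts, substitutions, `L₊` and the explicit polynomials `cub`, `gam`, `prodsq`,
translation covariance of the Liouville derivations, momentum reversal on generators, and the
calculus of the cubic `cub` (`∂³` trick, non-vanishing). [folklore]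
-/

noncomputable section

open MvPolynomial Finsupp
open scoped BigOperators

namespace Summit.AtomisticToContinuum.FouriersLaw.Theorems.OddChargeAlgebra

/-! ### The substitutions `killVar v` and `killP` -/

/-- `killVar v (X v) = 0`. [folklore] -/
@[simp] theorem killVar_X_self (v : Var) : killVar v (X v) = 0 := by simp [killVar]

/-- `killVar v` fixes the other variables. [folklore] -/
@[simp] theorem killVar_X_of_ne {v w : Var} (h : w ≠ v) : killVar v (X w) = X w := by
  simp [killVar, h]

/-- `killVar v` fixes constants. [folklore] -/
@[simp] theorem killVar_C (v : Var) (c : ℝ) : killVar v (C c) = C c := by simp [killVar]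

/-- `∂_w` commutes with `killVar v` for `w ≠ v`. [folklore] -/
theorem pderiv_killVar_of_ne {v w : Var} (h : w ≠ v) (f : R) :
    pderiv w (killVar v f) = killVar v (pderiv w f) := by
  classical
  refine (algHom_derivation_comm (φ := killVar v) (D := pderiv w) (D' := pderiv w)
    (fun u => ?_) f).symm
  by_cases hu : u = v
  · subst hu
    simp [pderiv_X_of_ne (Ne.symm h)]
  · by_cases huw : u = w
    · subst huw
      simp [hu]
    · simp [hu, pderiv_X_of_ne huw]

/-- `killVar v` is idempotent. [folklore] -/
theorem killVar_killVar (v : Var) (f : R) : killVar v (killVar v f) = killVar v f := by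
  have key : (killVar v).comp (killVar v) = killVar v := by
    refine MvPolynomial.algHom_ext fun w => ?_
    by_cases h : w = v
    · subst h
      simp
    · simp [h]
  exact DFunLike.congr_fun key f

/-- `killVar v f` is the remainder of `f` modulo `X v` (the monomials of `f` without `X v`).
[folklore] -/
theorem killVar_eq_modMonomial (v : Var) (f : R) :
    killVar v f = MvPolynomial.modMonomial f (Finsupp.single v 1) := by
  have hv : v ∉ (MvPolynomial.modMonomial f (Finsupp.single v 1)).vars := by
    intro hv
    obtain ⟨d, hd, hvd⟩ := (mem_vars_iff_mem_support v).mp hv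
    refine MvPolynomial.mem_support_iff.mp hd (coeff_modMonomial_of_le _ ?_)
    exact Finsupp.single_le_iff.mpr (Nat.one_le_iff_ne_zero.mpr (Finsupp.mem_support_iff.mp hvd))
  conv_lhs => rw [← modMonomial_add_divMonomial_single f v]
  rw [map_add, map_mul, killVar_X_self, zero_mul, add_zero, killVar_eq_self_of_not_mem_vars hv]

/-- If `f` vanishes at `X v = 0` then `f = X v · (f / X v)`. [folklore] -/
theorem eq_X_mul_divMonomial_of_killVar {v : Var} {f : R} (h : killVar v f = 0) :
    f = X v * MvPolynomial.divMonomial f (Finsupp.single v 1) := by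
  conv_lhs => rw [← modMonomial_add_divMonomial_single f v, ← killVar_eq_modMonomial, h,
    zero_add]

/-- A polynomial vanishing on the hyperplane `X v = 0` is a multiple of `X v`. [folklore] -/
theorem exists_eq_X_mul_of_killVar : ∀ (v : Var) (f : R), killVar v f = 0 →
    ∃ g : R, f = X v * g := by
  intro v f h
  exact ⟨_, eq_X_mul_divMonomial_of_killVar h⟩

/-- Division by a monomial does not enlarge the set of variables. [folklore] -/
theorem divMonomial_mem_supported {S : Set Var} {f : R} (hf : f ∈ supported ℝ S)
    (s : Var →₀ ℕ) : MvPolynomial.divMonomial f s ∈ supported ℝ S := by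
  rw [MvPolynomial.mem_supported] at hf ⊢
  intro v hv
  obtain ⟨d, hd, hvd⟩ := (mem_vars_iff_mem_support v).mp hv
  rw [MvPolynomial.mem_support_iff, coeff_divMonomial] at hd
  refine hf (support_subset_vars_of_mem_support (MvPolynomial.mem_support_iff.mpr hd) ?_)
  have hdv := Finsupp.mem_support_iff.mp hvd
  rw [Finsupp.mem_support_iff, Finsupp.coe_add, Pi.add_apply]
  omega

/-- A polynomial supported on `S` and vanishing at `X v = 0` is `X v` times a polynomial supported
on `S`. [folklore] -/
theorem exists_eq_X_mul_of_killVar_of_mem {S : Set Var} {v : Var} {f : R}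
    (hf : f ∈ supported ℝ S) (h : killVar v f = 0) : ∃ g, g ∈ supported ℝ S ∧ f = X v * g :=
  ⟨_, divMonomial_mem_supported hf _, eq_X_mul_divMonomial_of_killVar h⟩

/-- `killP` fixes positions. [folklore] -/
@[simp] theorem killP_X_inl (x : ℤ) : killP (X (Sum.inl x) : R) = X (Sum.inl x) := by simp [killP]

/-- `killP` kills momenta. [folklore] -/
@[simp] theorem killP_X_inr (x : ℤ) : killP (X (Sum.inr x) : R) = 0 := by simp [killP]

/-- `killP` fixes constants. [folklore] -/
@[simp] theorem killP_C (c : ℝ) : killP (C c : R) = C c := by simp [killP]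

/-- `∂_{q_x}` commutes with `killP`. [folklore] -/
theorem pderiv_inl_killP (x : ℤ) (f : R) :
    pderiv (Sum.inl x) (killP f) = killP (pderiv (Sum.inl x) f) := by
  refine (algHom_derivation_comm (fun u => ?_) f).symm
  rcases u with y | y
  · by_cases h : y = x
    · subst h
      simp
    · simp [pderiv_inl_X_inl_of_ne (Ne.symm h)]
  · simp

/-- `killP` fixes polynomials in the positions. [folklore] -/
theorem killP_eq_self_of_mem {f : R} (hf : f ∈ supported ℝ (Set.range (Sum.inl : ℤ → Var))) :
    killP f = f := by
  change killP.toRingHom f = RingHom.id R f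
  refine hom_congr_vars ?_ (fun i hi _ => ?_) rfl
  · ext r
    simp [MvPolynomial.algebraMap_eq]
  · obtain ⟨y, rfl⟩ := MvPolynomial.mem_supported.mp hf hi
    simp

/-- `killVar q_{x+1} ∘ S = S ∘ killVar q_x`. [folklore] -/
theorem killVar_inl_shift (x : ℤ) (f : R) :
    killVar (Sum.inl (x + 1)) (shift f) = shift (killVar (Sum.inl x) f) := by
  have key : (killVar (Sum.inl (x + 1))).comp shift = shift.comp (killVar (Sum.inl x)) := by
    refine MvPolynomial.algHom_ext fun w => ?_
    rcases w with y | y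
    · by_cases h : y = x
      · subst h
        simp
      · simp [h]
    · simp
  exact DFunLike.congr_fun key f

/-! ### Supports -/

/-- `∂_v` does not enlarge the set of variables. [folklore] -/
theorem pderiv_mem_supported {S : Set Var} {f : R} (hf : f ∈ supported ℝ S) (v : Var) :
    pderiv v f ∈ supported ℝ S := by
  classical
  refine derivation_mem_supported subset_rfl (fun w _ => ?_) hf
  rw [pderiv_X]
  simp only [Pi.single_apply]
  split_ifs
  exacts [one_mem _, zero_mem _]

/-- `∂_v f = 0` if `v` is outside a support set of `f`. [folklore] -/
theorem pderiv_eq_zero_of_not_mem_supported {S : Set Var} {f : R} {v : Var}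
    (hf : f ∈ supported ℝ S) (hv : v ∉ S) : pderiv v f = 0 :=
  pderiv_eq_zero_of_notMem_vars fun h => hv (MvPolynomial.mem_supported.mp hf h)

/-- `f` is supported on any set `S` with `∂_v f = 0` for all `v ∉ S`. [folklore] -/
theorem mem_supported_of_pderiv_eq_zero {S : Set Var} {f : R}
    (h : ∀ v, v ∉ S → pderiv v f = 0) : f ∈ supported ℝ S := by
  rw [MvPolynomial.mem_supported]
  intro v hv
  by_contra hvS
  exact not_mem_vars_of_pderiv_eq_zero (h v hvS) hv

/-- `shiftBy k` translates supports. [folklore] -/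
theorem shiftBy_mem_supported {S : Set Var} {f : R} (k : ℤ) (hf : f ∈ supported ℝ S) :
    shiftBy k f ∈ supported ℝ (transl k '' S) :=
  algHom_mem_supported (fun v hv => by
    rw [shiftBy_X]
    exact X_mem_supported.mpr ⟨v, hv, rfl⟩) hf

/-- `S` maps polynomials on the sites `a..b` to polynomials on the sites `a+1..b+1`. [folklore] -/
theorem shift_mem_supported_site {a b : ℤ} {f : R}
    (hf : f ∈ supported ℝ (Var.site ⁻¹' Set.Icc a b)) :
    shift f ∈ supported ℝ (Var.site ⁻¹' Set.Icc (a + 1) (b + 1)) := by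
  refine supported_mono ?_ (shiftBy_mem_supported 1 hf)
  rintro _ ⟨v, hv, rfl⟩
  simp only [Set.mem_preimage, Set.mem_Icc, site_transl] at hv ⊢
  omega

/-- `S` maps polynomials in `q_a..q_b` to polynomials in `q_{a+1}..q_{b+1}`. [folklore] -/
theorem shift_mem_supported_inl {a b : ℤ} {f : R}
    (hf : f ∈ supported ℝ (Sum.inl '' Set.Icc a b)) :
    shift f ∈ supported ℝ (Sum.inl '' Set.Icc (a + 1) (b + 1)) := by
  refine supported_mono ?_ (shiftBy_mem_supported 1 hf)
  rintro _ ⟨_, ⟨x, hx, rfl⟩, rfl⟩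
  rw [Set.mem_Icc] at hx
  exact ⟨x + 1, ⟨by omega, by omega⟩, rfl⟩

/-- `killVar v` does not enlarge supports. [folklore] -/
theorem killVar_mem_supported {S : Set Var} {f : R} (v : Var) (hf : f ∈ supported ℝ S) :
    killVar v f ∈ supported ℝ S := by
  refine algHom_mem_supported (fun w hw => ?_) hf
  by_cases h : w = v
  · rw [h, killVar_X_self]
    exact zero_mem _
  · rw [killVar_X_of_ne h]
    exact X_mem_supported.mpr hw

/-- `killP` lands in the position variables of the support. [folklore] -/
theorem killP_mem_supported {S : Set Var} {f : R} (hf : f ∈ supported ℝ S) :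
    killP f ∈ supported ℝ (S ∩ Set.range Sum.inl) := by
  refine algHom_mem_supported (fun w hw => ?_) hf
  rcases w with y | y
  · rw [killP_X_inl]
    exact X_mem_supported.mpr ⟨hw, y, rfl⟩
  · rw [killP_X_inr]
    exact zero_mem _

/-- `cub` preserves supports. [folklore] -/
theorem cub_mem_supported {S : Set Var} {a b : R} (ha : a ∈ supported ℝ S)
    (hb : b ∈ supported ℝ S) : cub a b ∈ supported ℝ S :=
  add_mem (sub_mem (pow_mem ha 3) (mul_mem (mul_mem (ofNat_mem _ 3) (pow_mem ha 2)) hb))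
    (mul_mem (mul_mem (ofNat_mem _ 3) ha) (pow_mem hb 2))

/-- Positions embed into "all variables of the sites". [folklore] -/
theorem inl_image_Icc_subset_site (a b : ℤ) :
    Sum.inl '' Set.Icc a b ⊆ Var.site ⁻¹' Set.Icc a b := by
  rintro _ ⟨x, hx, rfl⟩
  exact hx

/-- `γ_j ∈ ℝ[q_a, …, q_b]` for `a ≤ j`, `j + 1 ≤ b`. [folklore] -/
theorem gam_mem_supported_inl {a b : ℤ} {j : ℤ} (h1 : a ≤ j) (h2 : j + 1 ≤ b) :
    gam j ∈ supported ℝ (Sum.inl '' Set.Icc a b) :=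
  sub_mem (X_mem_supported.mpr ⟨j, ⟨h1, by omega⟩, rfl⟩)
    (X_mem_supported.mpr ⟨j + 1, ⟨by omega, h2⟩, rfl⟩)

/-- `∏_{j ∈ s} γ_j² ∈ ℝ[q_a, …, q_b]` when all bonds of `s` lie in `[a, b]`. [folklore] -/
theorem prodsq_mem_supported_inl {a b : ℤ} {s : Finset ℤ} (h : ∀ j ∈ s, a ≤ j ∧ j + 1 ≤ b) :
    prodsq s ∈ supported ℝ (Sum.inl '' Set.Icc a b) :=
  prod_mem fun j hj => pow_mem (gam_mem_supported_inl (h j hj).1 (h j hj).2) 2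

/-! ### The Liouville derivations and the shift -/

/-- `L₊ q_x = p_x`. [folklore] -/
@[simp] theorem lplus_X_inl (lam β : ℝ) (x : ℤ) :
    lplus lam β (X (Sum.inl x) : R) = X (Sum.inr x) := by
  simp [lplus, mkDerivation_X]

/-- `L₊ p_x = forcePlus x`. [folklore] -/
@[simp] theorem lplus_X_inr (lam β : ℝ) (x : ℤ) :
    lplus lam β (X (Sum.inr x) : R) = forcePlus lam β x := by
  simp [lplus, mkDerivation_X]

/-- `L q_x = p_x`. [folklore] -/
@[simp] theorem liouville_X_inl (ω₂ lam β : ℝ) (x : ℤ) :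
    liouville ω₂ lam β (X (Sum.inl x) : R) = X (Sum.inr x) := by
  simp [liouville, mkDerivation_X]

/-- `L p_x = force x`. [folklore] -/
@[simp] theorem liouville_X_inr (ω₂ lam β : ℝ) (x : ℤ) :
    liouville ω₂ lam β (X (Sum.inr x) : R) = force ω₂ lam β x := by
  simp [liouville, mkDerivation_X]

/-- The top-weight force is translation covariant. [folklore] -/
@[simp] theorem shift_forcePlus (lam β : ℝ) (x : ℤ) :
    shift (forcePlus lam β x) = forcePlus lam β (x + 1) := by
  simp only [forcePlus, map_add, map_neg, map_sub, map_mul, map_pow, shift_C, shift_X_inl,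
    sub_add_cancel, add_sub_cancel_right]

/-- The force is translation covariant. [folklore] -/
@[simp] theorem shift_force (ω₂ lam β : ℝ) (x : ℤ) :
    shift (force ω₂ lam β x) = force ω₂ lam β (x + 1) := by
  simp only [force, map_add, map_neg, map_sub, map_mul, map_pow, shift_C, shift_X_inl,
    sub_add_cancel, add_sub_cancel_right]

/-- `S ∘ L₊ = L₊ ∘ S`. [folklore] -/
theorem shift_lplus (lam β : ℝ) (f : R) : shift (lplus lam β f) = lplus lam β (shift f) :=
  algHom_derivation_comm (fun v => by rcases v with y | y <;> simp) f

/-- `S ∘ L = L ∘ S`. [folklore] -/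
theorem shift_liouville (ω₂ lam β : ℝ) (f : R) :
    shift (liouville ω₂ lam β f) = liouville ω₂ lam β (shift f) :=
  algHom_derivation_comm (fun v => by rcases v with y | y <;> simp) f

/-- `Θ q_x = q_x`. [folklore] -/
@[simp] theorem rev_X_inl (x : ℤ) : rev (X (Sum.inl x) : R) = X (Sum.inl x) := by simp [rev]

/-- `Θ p_x = -p_x`. [folklore] -/
@[simp] theorem rev_X_inr (x : ℤ) : rev (X (Sum.inr x) : R) = -X (Sum.inr x) := by simp [rev]

/-- `Θ` fixes constants. [folklore] -/
@[simp] theorem rev_C (c : ℝ) : rev (C c : R) = C c := by simp [rev]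

/-- `Θ` commutes with the shift. [folklore] -/
theorem shift_rev (f : R) : shift (rev f) = rev (shift f) := by
  have key : shift.comp rev = rev.comp shift := by
    refine MvPolynomial.algHom_ext fun w => ?_
    rcases w with y | y <;> simp
  exact DFunLike.congr_fun key f

/-- Substitutions of `0` for different variables commute. [folklore] -/
theorem killVar_comm (v w : Var) (f : R) : killVar v (killVar w f) = killVar w (killVar v f) := by
  have key : (killVar v).comp (killVar w) = (killVar w).comp (killVar v) := by
    refine MvPolynomial.algHom_ext fun u => ?_
    by_cases hu : u = w <;> by_cases hu' : u = v
    · subst hu; subst hu'; simp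
    · subst hu; simp [hu']
    · subst hu'; simp [hu]
    · simp [hu, hu']
  exact DFunLike.congr_fun key f

/-- `killP f` involves no momentum. [folklore] -/
theorem pderiv_inr_killP (x : ℤ) (f : R) : pderiv (Sum.inr x) (killP f) = 0 := by
  have hf : f ∈ supported ℝ (Set.univ : Set Var) := by
    rw [MvPolynomial.supported_univ]
    exact Algebra.mem_top
  refine pderiv_eq_zero_of_not_mem_supported (killP_mem_supported hf) ?_
  rintro ⟨-, ⟨y, hy⟩⟩
  exact Sum.inl_ne_inr hy

/-- The top-weight force on site `x` lives on the sites `x - 1, x, x + 1`. [folklore] -/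
theorem forcePlus_mem_supported_site (lam β : ℝ) {a b x : ℤ} (ha : a + 1 ≤ x) (hb : x + 1 ≤ b) :
    forcePlus lam β x ∈ supported ℝ (Var.site ⁻¹' Set.Icc a b) := by
  have hX : ∀ y : ℤ, a ≤ y → y ≤ b → (X (Sum.inl y) : R) ∈ supported ℝ (Var.site ⁻¹' Set.Icc a b) :=
    fun y h1 h2 => X_mem_supported.mpr ⟨h1, h2⟩
  have hC : ∀ c : ℝ, (C c : R) ∈ supported ℝ (Var.site ⁻¹' Set.Icc a b) :=
    fun c => Subalgebra.algebraMap_mem _ c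
  unfold forcePlus
  exact add_mem (neg_mem (mul_mem (hC _) (pow_mem (hX x (by omega) (by omega)) 3)))
    (mul_mem (hC _) (sub_mem (pow_mem (sub_mem (hX (x + 1) (by omega) hb)
      (hX x (by omega) (by omega))) 3) (pow_mem (sub_mem (hX x (by omega) (by omega))
      (hX (x - 1) (by omega) (by omega))) 3)))

/-- `L₊` spreads supports by one site on each side. [folklore] -/
theorem lplus_mem_supported_site (lam β : ℝ) {a b : ℤ} {f : R}
    (hf : f ∈ supported ℝ (Var.site ⁻¹' Set.Icc a b)) :
    lplus lam β f ∈ supported ℝ (Var.site ⁻¹' Set.Icc (a - 1) (b + 1)) := by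
  refine derivation_mem_supported (fun v hv => ?_) (fun v hv => ?_) hf
  · simp only [Set.mem_preimage, Set.mem_Icc] at hv ⊢
    omega
  · rcases v with y | y <;> have hy : a ≤ y ∧ y ≤ b := by simpa [Var.site] using hv
    · rw [lplus_X_inl]
      exact X_mem_supported.mpr (show a - 1 ≤ y ∧ y ≤ b + 1 by omega)
    · rw [lplus_X_inr]
      exact forcePlus_mem_supported_site lam β (by omega) (by omega)

/-! ### The cubic `cub` -/

/-- `∂_{q_i} cub(q_i, q_j) = 3 (q_i - q_j)²`. [folklore] -/
theorem pderiv_inl_cub_left {i j : ℤ} (h : i ≠ j) :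
    pderiv (Sum.inl i) (cub (X (Sum.inl i)) (X (Sum.inl j)) : R)
      = 3 * (X (Sum.inl i) - X (Sum.inl j)) ^ 2 := by
  simp only [cub, map_add, map_sub, pderiv_mul, pderiv_pow, pderiv_X_self,
    pderiv_inl_X_inl_of_ne h, pderiv_ofNat, Nat.cast_ofNat]
  ring

/-- `∂_{q_j} cub(q_i, q_j) = -3 q_i² + 6 q_i q_j`. [folklore] -/
theorem pderiv_inl_cub_right {i j : ℤ} (h : i ≠ j) :
    pderiv (Sum.inl j) (cub (X (Sum.inl i)) (X (Sum.inl j)) : R)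
      = -(3 * X (Sum.inl i) ^ 2) + 6 * X (Sum.inl i) * X (Sum.inl j) := by
  simp only [cub, map_add, map_sub, pderiv_mul, pderiv_pow, pderiv_X_self,
    pderiv_inl_X_inl_of_ne (Ne.symm h), pderiv_ofNat, Nat.cast_ofNat]
  ring

/-- `∂_{q_k} cub(q_i, q_j) = 0` for `k ∉ {i, j}`. [folklore] -/
theorem pderiv_inl_cub_of_ne {i j k : ℤ} (hi : k ≠ i) (hj : k ≠ j) :
    pderiv (Sum.inl k) (cub (X (Sum.inl i)) (X (Sum.inl j)) : R) = 0 := by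
  simp only [cub, map_add, map_sub, pderiv_mul, pderiv_pow, pderiv_inl_X_inl_of_ne hi,
    pderiv_inl_X_inl_of_ne hj, pderiv_ofNat, Nat.cast_ofNat]
  ring

/-- `∂_{p_k} cub(q_i, q_j) = 0`. [folklore] -/
theorem pderiv_inr_cub (i j k : ℤ) :
    pderiv (Sum.inr k) (cub (X (Sum.inl i)) (X (Sum.inl j)) : R) = 0 := by
  simp only [cub, map_add, map_sub, pderiv_mul, pderiv_pow, pderiv_ofNat, Nat.cast_ofNat,
    pderiv_X_of_ne (show (Sum.inl i : Var) ≠ Sum.inr k from Sum.inl_ne_inr),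
    pderiv_X_of_ne (show (Sum.inl j : Var) ≠ Sum.inr k from Sum.inl_ne_inr)]
  ring

/-- The `∂³` trick: `∂_{q_i}³ (cub(q_i,q_j) g) = 6 g` when `g` is free of `q_i`. [folklore] -/
theorem pderiv3_cub_mul {i j : ℤ} (h : i ≠ j) {g : R} (hg : pderiv (Sum.inl i) g = 0) :
    pderiv (Sum.inl i) (pderiv (Sum.inl i) (pderiv (Sum.inl i)
      (cub (X (Sum.inl i)) (X (Sum.inl j)) * g))) = 6 * g := by
  simp only [cub, pow_succ, pow_zero, one_mul, map_add, map_sub, pderiv_mul, pderiv_X_self,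
    pderiv_inl_X_inl_of_ne h, pderiv_ofNat, Derivation.map_one_eq_zero, hg, mul_zero, zero_mul,
    add_zero, mul_one, zero_add]
  ring

/-- `cub(q_i, q_j)` vanishes on the hyperplane `q_i = 0`. [folklore] -/
theorem killVar_inl_cub_left {i j : ℤ} (_h : i ≠ j) :
    killVar (Sum.inl i) (cub (X (Sum.inl i)) (X (Sum.inl j)) : R) = 0 := by
  simp [cub, killVar]

end Summit.AtomisticToContinuum.FouriersLaw.Theorems.OddChargeAlgebra

end
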